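import Summits.HodgeConjecture.CorCM.GenericCMFieldSameFieldFamiliesHodge
import Literature.AlgebraicGeometry.Milne1999.CMHodgeHypothesisFromCMTypedProducts
import Literature.AlgebraicGeometry.Pohlmann1968.CMFamilyRankSlots
import HarnessLib

/-!
# Up to three pairwise non-isogenous CM abelian varieties whose CM fields are ISOMORPHIC to one pair-flip CM field:
# the family is nondegenerate; more than `[K₀:ℚ]/2` of them: degenerate

COR-CM (cell `pub-hodgecm2`, binder seat `b16` gen 43, count-neutral claim CM-DIMLE3-PRODUCTS, file D2; theorems only, no
definition, no named fact, no `sorry`).  NEW as stated, hence under `Summits/`.  Seat p2's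
`GenericCMField.isNondegenerateFamily_of_card_le_three` / `card_le_finrank_div_two_of_isNondegenerateFamily`
(`CorCM/GenericCMFieldSameFieldFamiliesHodge`, `CorCM/GenericCMFieldTypes`) are stated for ONE CM field `K₀` carrying all
the types (the constant family `fun _ => K₀`).  In a family `(K_j, Φ_j)_j` of CM fields indexed by the members of a block
the fields are only ISOMORPHIC to a common `K₀` (`e_j : K_j ≃ K₀`); this file transports along the `e_j`:

* `cmFamilyRank_eq_cmFamilyRank_cmTypeMap` — `rank((Φ_j)_j) = rank((Φ_j^{e_j})_j)` for the transported types
  `Φ_j^{e_j} = {σ | σ ∘ e_j ∈ Φ_j}` of `K₀` (Kubota's rank along the equivariant bijection `(j, σ) ↦ (j, σ ∘ e_j)` of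
  `⊔_j Hom(K₀, ℂ)` onto `⊔_j Hom(K_j, ℂ)`); `isNondegenerateFamily_iff_cmTypeMap`;
* **`isNondegenerateFamily_of_ringEquiv_of_pairFlip_of_card_le_three`** — at most three pairwise non-isogenous CM abelian
  varieties realising types of fields `K_j ≅ K₀`, `K₀` with pair flips: nondegenerate family (realisations transported by
  `IsCMTypeRealisation.transport`);
* **`not_isNondegenerateFamily_of_ringEquiv_of_lt_card`** — more than `[K₀ : ℚ]/2` members with `K_j ≅ K₀`: degenerate
  (for any CM field `K₀`).

HC_CM is NOT touched.

## References

* [Gordon1999HodgeAVSurvey] B. B. Gordon, *A survey of the Hodge conjecture for abelian varieties*, §3 Theorem, 7.4–7.7.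
* [Dodson1984] B. Dodson, *The structure of Galois groups of CM-fields*, Trans. AMS 283 (1984), §5.1.2.
* [Shimura1998] G. Shimura, *Abelian Varieties with Complex Multiplication and Modular Functions*, §32.7 (rank along a
  relabelling of the embeddings).
-/

noncomputable section

open CategoryTheory CategoryTheory.Limits NumberField Module

namespace Summit.HodgeConjecture.CorCM

open Literature.NumberTheory.ComplexMultiplication
open Literature.NumberTheory.Automorphic (PicardCM.CMCode.cmTypeMap PicardCM.CMCode.mem_cmTypeMap_iff)
open Literature.AlgebraicGeometry.Motives (AbelianVariety CMType)
open Literature.AlgebraicGeometry.HodgeTheory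
open Literature.AlgebraicGeometry.ComplexMultiplication (IsCMTypeRealisation)
open Literature.AlgebraicGeometry.Pohlmann1968

variable {J : Type} {K : J → Type} [∀ j, Field (K j)] [∀ j, NumberField (K j)] [∀ j, IsCMField (K j)]
  {K₀ : Type} [Field K₀] [NumberField K₀] [IsCMField K₀]

/-! ## §1 Rank transport along slotwise field isomorphisms -/

section Transport

omit [∀ j, NumberField (K j)] [∀ j, IsCMField (K j)] [NumberField K₀] [IsCMField K₀] in
/-- **Kubota's rank is unchanged by transporting every type along a field isomorphism `e_j : K_j ≃ K₀`**: the map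
`(j, σ) ↦ (j, σ ∘ e_j)` is an `Aut(ℂ)`-equivariant bijection `⊔_j Hom(K₀, ℂ) → ⊔_j Hom(K_j, ℂ)` pulling the family type of
`(Φ_j)_j` back to that of `(Φ_j^{e_j})_j`. [cite: Shimura1998, §32.7] -/
theorem cmFamilyRank_eq_cmFamilyRank_cmTypeMap (e : ∀ j, K j ≃+* K₀) (Φ : ∀ j, CMType (K j)) :
    CMAlgebra.cmFamilyRank Φ =
      CMAlgebra.cmFamilyRank (K := fun _ : J => K₀) fun j => PicardCM.CMCode.cmTypeMap (e j) (Φ j) := by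
  let p : ((j : J) × (K₀ →+* ℂ)) → (j : J) × (K j →+* ℂ) := fun x => ⟨x.1, x.2.comp (e x.1).toRingHom⟩
  have hp : ∀ (g : ℂ ≃+* ℂ) (x : (j : J) × (K₀ →+* ℂ)), p (g • x) = g • p x := fun _ _ => rfl
  have hsurj : Function.Surjective p := by
    rintro ⟨j, s⟩
    refine ⟨⟨j, s.comp (e j).symm.toRingHom⟩, ?_⟩
    change (⟨j, (s.comp (e j).symm.toRingHom).comp (e j).toRingHom⟩ : (j : J) × (K j →+* ℂ)) = ⟨j, s⟩
    congr 1
    exact RingHom.ext fun x => by simp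
  have hpre : p ⁻¹' CMAlgebra.familyType Φ =
      CMAlgebra.familyType (K := fun _ : J => K₀) fun j => PicardCM.CMCode.cmTypeMap (e j) (Φ j) := by
    ext x
    rfl
  unfold CMAlgebra.cmFamilyRank
  rw [← hpre, typeRank_preimage_eq_of_surjective _ p hp hsurj]

omit [∀ j, IsCMField (K j)] [IsCMField K₀] in
/-- **Nondegeneracy is unchanged by transporting every type along `e_j : K_j ≃ K₀`** (same rank, same degrees).
[cite: Gordon1999HodgeAVSurvey, 7.5] -/
theorem isNondegenerateFamily_iff_cmTypeMap [Fintype J] (e : ∀ j, K j ≃+* K₀) (Φ : ∀ j, CMType (K j)) :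
    CMAlgebra.IsNondegenerateFamily Φ ↔
      CMAlgebra.IsNondegenerateFamily (K := fun _ : J => K₀) fun j => PicardCM.CMCode.cmTypeMap (e j) (Φ j) := by
  have hdeg : ∀ j, finrank ℚ (K j) = finrank ℚ K₀ := fun j =>
    (AlgEquiv.ofRingEquiv (f := e j) (fun q => by simp) : K j ≃ₐ[ℚ] K₀).toLinearEquiv.finrank_eq
  rw [CMAlgebra.isNondegenerateFamily_iff, CMAlgebra.isNondegenerateFamily_iff, cmFamilyRank_eq_cmFamilyRank_cmTypeMap e]
  simp only [hdeg]

end Transport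

/-! ## §2 Families with fields isomorphic to one pair-flip CM field -/

section PairFlip

variable [Fintype J] [Nonempty J] {Φ : ∀ j, CMType (K j)} {A : J → AbelianVariety ℂ} {ι : ∀ j, 𝓞 (K j) →+* End (A j)}
  {θ : ∀ j, K j →+* Module.End ℂ (complexBetti (A j).X 1)}

omit [∀ j, IsCMField (K j)] in
/-- **At most three pairwise non-isogenous CM abelian varieties whose CM fields are isomorphic to ONE CM field `K₀` with
pair flips: the family of their types is nondegenerate** (`Hg(∏ A_j) = ∏ Hg(A_j)`; seat p2's theorem, transported).
[cite: Dodson1984, §5.1.2 Theorem] [cite: Gordon1999HodgeAVSurvey, §3 Theorem and 7.5] -/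
theorem isNondegenerateFamily_of_ringEquiv_of_pairFlip_of_card_le_three (e : ∀ j, K j ≃+* K₀)
    (hflip : ∀ s : K₀ →+* ℂ, ∃ σ : ℂ ≃+* ℂ, σ • s = (starRingAut : ℂ ≃+* ℂ) • s ∧
      ∀ t : K₀ →+* ℂ, t ≠ s → t ≠ (starRingAut : ℂ ≃+* ℂ) • s → σ • t = t)
    (hA : ∀ j, IsCMTypeRealisation (Φ j) (A j) (ι j) (θ j))
    (hniso : ∀ i j, i ≠ j → ¬ AbelianVariety.IsIsogenous (A i) (A j)) (hcard : Fintype.card J ≤ 3) :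
    CMAlgebra.IsNondegenerateFamily Φ := by
  rw [isNondegenerateFamily_iff_cmTypeMap e]
  exact GenericCMField.isNondegenerateFamily_of_card_le_three hflip (fun j => (hA j).transport (e j)) hniso hcard

omit [∀ j, IsCMField (K j)] in
/-- **More than `[K₀ : ℚ]/2` members with fields isomorphic to one CM field `K₀`: the family is degenerate** (at most `n`
pairwise CM-inequivalent types of a CM field of degree `2n` can be jointly nondegenerate; seat p2's bound, transported).
[cite: Gordon1999HodgeAVSurvey, 7.5–7.7] -/
theorem not_isNondegenerateFamily_of_ringEquiv_of_lt_card (e : ∀ j, K j ≃+* K₀) (Φ : ∀ j, CMType (K j))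
    (hcard : finrank ℚ K₀ / 2 < Fintype.card J) : ¬ CMAlgebra.IsNondegenerateFamily Φ := fun h =>
  absurd (GenericCMField.card_le_finrank_div_two_of_isNondegenerateFamily _ ((isNondegenerateFamily_iff_cmTypeMap e Φ).1 h))
    (not_le.2 hcard)

/-- **The Hodge conjecture on every product** of at most three pairwise non-isogenous CM abelian varieties whose CM fields
are isomorphic to one pair-flip field, UNCONDITIONALLY. [cite: Gordon1999HodgeAVSurvey, 7.5 and 10.10] -/
theorem hodgeConjectureFor_prod_of_ringEquiv_of_pairFlip_of_card_le_three (e : ∀ j, K j ≃+* K₀)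
    (hflip : ∀ s : K₀ →+* ℂ, ∃ σ : ℂ ≃+* ℂ, σ • s = (starRingAut : ℂ ≃+* ℂ) • s ∧
      ∀ t : K₀ →+* ℂ, t ≠ s → t ≠ (starRingAut : ℂ ≃+* ℂ) • s → σ • t = t)
    (hA : ∀ j, IsCMTypeRealisation (Φ j) (A j) (ι j) (θ j))
    (hniso : ∀ i j, i ≠ j → ¬ AbelianVariety.IsIsogenous (A i) (A j)) (hcard : Fintype.card J ≤ 3)
    {N : ℕ} (π : Fin N → J) : HodgeConjectureFor (⨁ fun j : Fin N => A (π j)).dim (⨁ fun j : Fin N => A (π j)).X :=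
  (isNondegenerateFamily_of_ringEquiv_of_pairFlip_of_card_le_three e hflip hA hniso hcard).hodgeConjectureFor_prod hA π

end PairFlip

end Summit.HodgeConjecture.CorCM

end
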